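import Literature.Topology.FourManifolds.CappellShanesonHomology
import Literature.Topology.FourManifolds.ConnectedSumEulerCharacteristic
import Literature.Topology.Euclidean.PoincareHopfLevelSurface
import Literature.AlgebraicTopology.SingularHomology.PairTimesCircle
import Mathlib.Analysis.SpecialFunctions.Complex.Circle
import HarnessLib

/-!
# Euler characteristics of the model pieces of a circle surgery

Topic `Literature/Topology/FourManifolds`.  Preparatory counts for
`CircleSurgeryEulerCharacteristic.lean` (`χ(X_ℓ) = χ(X) + 2` for surgery on a circle in a
closed 4-manifold; Gompf–Stipsicz (1999) §5.2).  The surgery `X_ℓ = (X ∖ ℓ(S¹)) ∪ (D̊² × S²)`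
(`Literature.Topology.FourManifolds.IsCircleSurgery`) is covered by two open pieces modelled on
`S¹ × ℝ³` (the tube) and `D̊² × S²` (the new piece), overlapping in `S¹ × (ℝ³ ∖ 0)` resp.
`(D̊² ∖ 0) × S²`; we record the Euler characteristic (the tree's `relEuler ℤ ℤ · ∅`) and the
finite type of the integral homology (`FinRelHomology`) of each model:
`finRelHomology_sphere_one` (`χ(S¹) = 0`), `finRelHomology_sphereOne_prod_sphereTwo`
(`χ(S¹ × S²) = 0`, from the tree's `FinRelHomology.addCircle_prod`),
`finRelHomology_sphereOne_prod_space` (`S¹ × ℝ³ ≃ₕ S¹`), `finRelHomology_discTimesSphere`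
(`D̊² × S² ≃ₕ S²`, `χ = 2`), `finRelHomology_puncturedTube` (`S¹ × (ℝ³ ∖ 0) ≃ₕ S¹ × S²`); the punctured new piece
`(D̊² ∖ 0) × S²` is treated in the sequel.  The homotopy equivalences
are straight-line deformations in a Euclidean factor (Hatcher 2002, proof of Thm. 2.26).
Everything is proved; no named facts.

## References

* A. Hatcher, *Algebraic Topology* (2002), Cor. 2.11, Cor. 2.14, Thm. 2.26, Thm. 2.44.
  [HatcherAT2002]
* R. E. Gompf, A. I. Stipsicz, *4-Manifolds and Kirby Calculus* (1999), §5.2.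
  [GompfStipsiczGSM1999]
-/

noncomputable section

open Set Function CategoryTheory CategoryTheory.Limits Module
open scoped Manifold ContDiff Topology unitInterval
open Literature.AlgebraicTopology.SingularHomology

namespace Literature.Topology.FourManifolds

/-! ### Transfer of finite type and `χ` along homotopy equivalences and homeomorphisms -/

/-- Finite type and the Euler characteristic pass along a homotopy equivalence (homotopy
invariance of singular homology, Hatcher Cor. 2.11; the tree's
`singularHomology.isoOfHomotopyEquiv`).
[cite: HatcherAT2002, Cor. 2.11] -/
theorem finRelHomology_and_relEuler_of_homotopyEquiv {A B : Type} [TopologicalSpace A]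
    [TopologicalSpace B] (e : ContinuousMap.HomotopyEquiv A B) {N : ℕ} {χ : ℤ}
    (h : FinRelHomology ℤ ℤ A ∅ N ∧ relEuler ℤ ℤ A ∅ = χ) :
    FinRelHomology ℤ ℤ B ∅ N ∧ relEuler ℤ ℤ B ∅ = χ := by
  let ek : ∀ k, relativeSingularHomology ℤ ℤ A ∅ k ≅ relativeSingularHomology ℤ ℤ B ∅ k :=
    fun k => (relativeSingularHomology.emptyIso ℤ ℤ _ k).symm ≪≫
      singularHomology.isoOfHomotopyEquiv ℤ ℤ e k ≪≫ relativeSingularHomology.emptyIso ℤ ℤ _ k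
  exact ⟨h.1.of_iso ek, (relEuler_eq_of_iso ek).symm.trans h.2⟩

/-- Finite type and the Euler characteristic pass along a homeomorphism.
[cite: HatcherAT2002, §2.1 (maps of pairs, before Prop. 2.19)] -/
theorem finRelHomology_and_relEuler_of_homeomorph {A B : Type} [TopologicalSpace A]
    [TopologicalSpace B] (e : A ≃ₜ B) {N : ℕ} {χ : ℤ}
    (h : FinRelHomology ℤ ℤ A ∅ N ∧ relEuler ℤ ℤ A ∅ = χ) :
    FinRelHomology ℤ ℤ B ∅ N ∧ relEuler ℤ ℤ B ∅ = χ := by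
  refine ⟨h.1.of_homeomorph e (mapsTo_empty _ _) (mapsTo_empty _ _), ?_⟩
  rw [← h.2]
  exact (relEuler_eq_of_homeomorph (R := ℤ) (M := ℤ) (A := (∅ : Set A)) e (mapsTo_empty _ _)
    (mapsTo_empty _ _)).symm

/-! ### `χ(S¹) = 0` and `χ(S¹ × S²) = 0` -/

/-- `1 < dim ℝⁿ⁺²`. [folklore] -/
private theorem one_lt_rank_euclideanSpace_models (n : ℕ) :
    1 < Module.rank ℝ (EuclideanSpace ℝ (Fin (n + 2))) := by
  rw [← Module.finrank_eq_rank, finrank_euclideanSpace, Fintype.card_fin]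
  norm_cast
  omega

/-- **`χ(S¹) = 0`, with finiteness**: the integral homology of the round circle `S¹ ⊆ ℝ²` is
`ℤ, ℤ, 0, …` (Hatcher 2002, Cor. 2.14, the tree's PROVED `isHomologySphere_sphere`), so it is
finitely generated, vanishes from degree `2` on, and `χ(S¹) = 1 - 1 = 0`. [cite: HatcherAT2002, Cor. 2.14] -/
theorem finRelHomology_sphere_one :
    FinRelHomology ℤ ℤ ↥(Metric.sphere (0 : EuclideanSpace ℝ (Fin 2)) 1) ∅ 2 ∧
      relEuler ℤ ℤ ↥(Metric.sphere (0 : EuclideanSpace ℝ (Fin 2)) 1) ∅ = 0 := by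
  have hS : IsHomologySphere (Metric.sphere (0 : EuclideanSpace ℝ (Fin 2)) 1) 1 :=
    isHomologySphere_sphere (n := 1) le_rfl
  haveI : PathConnectedSpace (Metric.sphere (0 : EuclideanSpace ℝ (Fin 2)) 1) :=
    isPathConnected_iff_pathConnectedSpace.mp
      (isPathConnected_sphere (one_lt_rank_euclideanSpace_models 0) 0 zero_le_one)
  haveI := singularHomology.isIso_ε_of_pathConnectedSpace ℤ ℤ
    (X := Metric.sphere (0 : EuclideanSpace ℝ (Fin 2)) 1)
  let e0 : singularHomology ℤ ℤ (Metric.sphere (0 : EuclideanSpace ℝ (Fin 2)) 1) 0 ≅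
      ModuleCat.of ℤ (ULift.{0} ℤ) :=
    asIso (singularHomology.ε ℤ ℤ (Metric.sphere (0 : EuclideanSpace ℝ (Fin 2)) 1))
  let e1 : singularHomology ℤ ℤ (Metric.sphere (0 : EuclideanSpace ℝ (Fin 2)) 1) 1 ≅
      ModuleCat.of ℤ (ULift.{0} ℤ) :=
    hS.nonempty_iso.some
  have hZ : ∀ k, k ≠ 0 → k ≠ 1 →
      IsZero (singularHomology ℤ ℤ (Metric.sphere (0 : EuclideanSpace ℝ (Fin 2)) 1) k) :=
    fun k hk0 hk1 => hS.1 k (Nat.pos_of_ne_zero hk0) hk1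
  have hfin : ∀ k,
      Module.Finite ℤ (singularHomology ℤ ℤ (Metric.sphere (0 : EuclideanSpace ℝ (Fin 2)) 1) k) := by
    intro k
    by_cases hk0 : k = 0
    · subst hk0; exact Module.Finite.equiv e0.toLinearEquiv.symm
    by_cases hk1 : k = 1
    · subst hk1; exact Module.Finite.equiv e1.toLinearEquiv.symm
    exact finite_of_isZero (hZ k hk0 hk1)
  have h : FinRelHomology ℤ ℤ (Metric.sphere (0 : EuclideanSpace ℝ (Fin 2)) 1) ∅ 2 :=
    FinRelHomology.empty_of_absolute hfin fun k hk => hZ k (by omega) (by omega)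
  refine ⟨h, ?_⟩
  rw [h.relEuler_empty_eq_sum]
  simp only [Finset.sum_range_succ, Finset.sum_range_zero]
  rw [e0.toLinearEquiv.finrank_eq, e1.toLinearEquiv.finrank_eq, finrank_ulift_int]
  norm_num

/-- **The circle group `Circle ⊆ ℂ` is homeomorphic to the round `S¹ ⊆ ℝ²`** (the linear
isometry `ℂ ≃ ℝ²` of the orthonormal basis `(1, i)` maps the unit sphere onto the unit sphere).
[folklore] -/
theorem nonempty_circleHomeomorphSphereOne :
    Nonempty (Circle ≃ₜ ↥(Metric.sphere (0 : EuclideanSpace ℝ (Fin 2)) 1)) :=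
  have h : (Complex.orthonormalBasisOneI.repr.toHomeomorph : ℂ ≃ₜ EuclideanSpace ℝ (Fin 2)) ''
      Metric.sphere (0 : ℂ) 1 = (Metric.sphere (0 : EuclideanSpace ℝ (Fin 2)) 1) := by
    have h := Complex.orthonormalBasisOneI.repr.toIsometryEquiv.image_sphere 0 1
    rw [LinearIsometryEquiv.coe_toIsometryEquiv, map_zero] at h
    exact h
  ⟨((Complex.orthonormalBasisOneI.repr.toHomeomorph.image (Metric.sphere (0 : ℂ) 1)).trans
    (Homeomorph.setCongr h) :
      ↥(Metric.sphere (0 : ℂ) 1) ≃ₜ (Metric.sphere (0 : EuclideanSpace ℝ (Fin 2)) 1))⟩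

/-- **`χ(S¹ × S²) = 0`, with finiteness** (`S¹ ⊆ ℝ²`, `S² ⊆ ℝ³` round): `χ(ℝ/ℤ × K) = 0` for `K`
of finite type (the tree's `FinRelHomology.addCircle_prod`, Hatcher Thm. 2.44 along the pair
`(S¹ × K, D × K)`), `K = S²` (`finRelHomology_sphere_two`), and `ℝ/ℤ ≅ Circle ≅ S¹`.
[cite: HatcherAT2002, §2.2 Thm. 2.44] -/
theorem finRelHomology_sphereOne_prod_sphereTwo :
    FinRelHomology ℤ ℤ (↥(Metric.sphere (0 : EuclideanSpace ℝ (Fin 2)) 1) ×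
        ↥(Metric.sphere (0 : EuclideanSpace ℝ (Fin 3)) 1)) ∅ 4 ∧
      relEuler ℤ ℤ (↥(Metric.sphere (0 : EuclideanSpace ℝ (Fin 2)) 1) ×
        ↥(Metric.sphere (0 : EuclideanSpace ℝ (Fin 3)) 1)) ∅ = 0 := by
  obtain ⟨h2, -⟩ := Literature.Topology.Euclidean.finRelHomology_sphere_two
  have h := FinRelHomology.addCircle_prod ℤ ℤ h2
  let e : AddCircle (1 : ℝ) × ↥(Metric.sphere (0 : EuclideanSpace ℝ (Fin 3)) 1) ≃ₜ
      ↥(Metric.sphere (0 : EuclideanSpace ℝ (Fin 2)) 1) ×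
        ↥(Metric.sphere (0 : EuclideanSpace ℝ (Fin 3)) 1) :=
    ((AddCircle.homeomorphCircle one_ne_zero).trans nonempty_circleHomeomorphSphereOne.some).prodCongr
      (Homeomorph.refl _)
  exact finRelHomology_and_relEuler_of_homeomorph e h

/-! ### The tube `S¹ × ℝ³` and the new piece `D̊² × S²` -/

/-- **`K × E ≃ₕ K` for a real normed space `E`**: the projection and the zero section are
homotopy inverse through the straight-line contraction `(k, v) ↦ (k, t • v)` of the second factor
(Hatcher 2002, Ch. 0, contractible factors). [cite: HatcherAT2002, Cor. 2.11] -/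
theorem nonempty_prodSpaceHomotopyEquiv (K E : Type) [TopologicalSpace K] [NormedAddCommGroup E]
    [NormedSpace ℝ E] : Nonempty (ContinuousMap.HomotopyEquiv (K × E) K) := by
  have h : (⟨Prod.fst, continuous_fst⟩ : C(K × E, K)).comp ⟨fun k => (k, (0 : E)), by fun_prop⟩ =
      ContinuousMap.id K := by
    ext k; rfl
  exact
    ⟨{ toFun := ⟨Prod.fst, continuous_fst⟩
       invFun := ⟨fun k => (k, 0), by fun_prop⟩
       left_inv :=
         ⟨{ toFun := fun p => (p.2.1, (p.1 : ℝ) • p.2.2)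
            continuous_toFun := by fun_prop
            map_zero_left := fun x => by simp
            map_one_left := fun x => by simp }⟩
       right_inv := by rw [h] }⟩

/-- **`χ(S¹ × ℝ³) = 0`, with finiteness** (`S¹ × ℝ³ ≃ₕ S¹`, `χ(S¹) = 0`).
[cite: HatcherAT2002, Cor. 2.11 and Cor. 2.14] -/
theorem finRelHomology_sphereOne_prod_space :
    FinRelHomology ℤ ℤ (↥(Metric.sphere (0 : EuclideanSpace ℝ (Fin 2)) 1) ×
        EuclideanSpace ℝ (Fin 3)) ∅ 2 ∧
      relEuler ℤ ℤ (↥(Metric.sphere (0 : EuclideanSpace ℝ (Fin 2)) 1) ×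
        EuclideanSpace ℝ (Fin 3)) ∅ = 0 :=
  finRelHomology_and_relEuler_of_homotopyEquiv
    (nonempty_prodSpaceHomotopyEquiv _ (EuclideanSpace ℝ (Fin 3))).some.symm
    finRelHomology_sphere_one

/-- **`D̊² × S² ≃ₕ S²`**: the new piece `Literature.Topology.FourManifolds.discTimesSphere`
(`{(w, v) | ‖w‖ < 1} ⊆ ℝ² × S²`) deformation retracts onto its core sphere `{0} × S²` by the
straight-line contraction `(w, v) ↦ (t • w, v)` of the disc factor. [cite: HatcherAT2002, Cor. 2.11] -/
theorem discTimesSphere.nonempty_homotopyEquiv :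
    Nonempty (ContinuousMap.HomotopyEquiv ↥discTimesSphere
      ↥(Metric.sphere (0 : EuclideanSpace ℝ (Fin 3)) 1)) :=
  ⟨{
  toFun := ⟨fun b => (b : EuclideanSpace ℝ (Fin 2) × ↥(Metric.sphere (0 : EuclideanSpace ℝ (Fin 3)) 1)).2,
    by fun_prop⟩
  invFun := ⟨fun v => ⟨((0 : EuclideanSpace ℝ (Fin 2)), v), by simp [mem_discTimesSphere_iff]⟩,
    by fun_prop⟩
  left_inv :=
    ⟨{ toFun := fun p => ⟨((p.1 : ℝ) • (p.2 : EuclideanSpace ℝ (Fin 2) ×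
            ↥(Metric.sphere (0 : EuclideanSpace ℝ (Fin 3)) 1)).1,
          (p.2 : EuclideanSpace ℝ (Fin 2) × ↥(Metric.sphere (0 : EuclideanSpace ℝ (Fin 3)) 1)).2), by
          rw [mem_discTimesSphere_iff, norm_smul, Real.norm_eq_abs, abs_of_nonneg p.1.2.1]
          exact lt_of_le_of_lt (mul_le_of_le_one_left (norm_nonneg _) p.1.2.2) p.2.2⟩
       continuous_toFun := by
         apply Continuous.subtype_mk
         fun_prop
       map_zero_left := fun x => by
         apply Subtype.ext
         simp
       map_one_left := fun x => by
         apply Subtype.ext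
         simp }⟩
  right_inv := by
    refine ⟨ContinuousMap.Homotopy.refl _ |>.cast ?_ rfl⟩
    ext v : 1
    rfl }⟩

/-- **`χ(D̊² × S²) = 2`, with finiteness** (`D̊² × S² ≃ₕ S²`, `χ(S²) = 2`,
`Literature.Topology.Euclidean.finRelHomology_sphere_two`). [cite: HatcherAT2002, Cor. 2.11 and Cor. 2.14] -/
theorem finRelHomology_discTimesSphere :
    FinRelHomology ℤ ℤ ↥discTimesSphere ∅ 3 ∧ relEuler ℤ ℤ ↥discTimesSphere ∅ = 2 :=
  finRelHomology_and_relEuler_of_homotopyEquiv discTimesSphere.nonempty_homotopyEquiv.some.symm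
    Literature.Topology.Euclidean.finRelHomology_sphere_two

/-! ### The punctured tube `S¹ × (ℝ³ ∖ 0)` -/

/-- **`S¹ × (ℝ³ ∖ 0) ≃ₕ S¹ × S²`**: radial retraction of the second factor onto the unit sphere,
`v ↦ v / ‖v‖`, homotopy inverse to the inclusion through `((1 - t)/‖v‖ + t) v` (Hatcher 2002,
proof of Thm. 2.26). [cite: HatcherAT2002, Thm. 2.26 (proof)] -/
theorem nonempty_homotopyEquiv_puncturedTube :
    Nonempty (ContinuousMap.HomotopyEquiv
      ↥((Set.univ : Set ↥(Metric.sphere (0 : EuclideanSpace ℝ (Fin 2)) 1)) ×ˢ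
        ({0}ᶜ : Set (EuclideanSpace ℝ (Fin 3))))
      (↥(Metric.sphere (0 : EuclideanSpace ℝ (Fin 2)) 1) ×
        ↥(Metric.sphere (0 : EuclideanSpace ℝ (Fin 3)) 1))) := by
  -- abbreviations
  let S1 := ↥(Metric.sphere (0 : EuclideanSpace ℝ (Fin 2)) 1)
  let E3 := EuclideanSpace ℝ (Fin 3)
  let puncturedTube : Set (S1 × E3) := (Set.univ : Set S1) ×ˢ ({0}ᶜ : Set E3)
  change Nonempty (ContinuousMap.HomotopyEquiv ↥puncturedTube (S1 × ↥(Metric.sphere (0 : E3) 1)))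
  have hne : ∀ p : ↥puncturedTube, (p : S1 × E3).2 ≠ 0 := fun p => p.2.2
  have hpos : ∀ p : ↥puncturedTube, 0 < ‖(p : S1 × E3).2‖ := fun p => norm_pos_iff.2 (hne p)
  -- the radial retraction
  have hgm : ∀ p : ↥puncturedTube,
      ‖(p : S1 × E3).2‖⁻¹ • (p : S1 × E3).2 ∈ Metric.sphere (0 : E3) 1 := fun p => by
    rw [mem_sphere_zero_iff_norm, norm_smul, norm_inv, norm_norm, inv_mul_cancel₀ (hpos p).ne']
  have hgc : Continuous fun p : ↥puncturedTube => ‖(p : S1 × E3).2‖⁻¹ • (p : S1 × E3).2 :=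
    ((continuous_snd.comp continuous_subtype_val).norm.inv₀ fun p => (hpos p).ne').smul
      (continuous_snd.comp continuous_subtype_val)
  let g : C(↥puncturedTube, S1 × ↥(Metric.sphere (0 : E3) 1)) :=
    ⟨fun p => ((p : S1 × E3).1, ⟨‖(p : S1 × E3).2‖⁻¹ • (p : S1 × E3).2, hgm p⟩),
      (continuous_fst.comp continuous_subtype_val).prodMk (hgc.subtype_mk hgm)⟩
  -- the inclusion
  have hfm : ∀ q : S1 × ↥(Metric.sphere (0 : E3) 1), ((q.1, (q.2 : E3)) : S1 × E3) ∈ puncturedTube :=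
    fun q => ⟨trivial, by
      have h := q.2.2
      rw [mem_sphere_zero_iff_norm] at h
      change (q.2 : E3) ≠ 0
      rw [← norm_ne_zero_iff, h]
      exact one_ne_zero⟩
  let f : C(S1 × ↥(Metric.sphere (0 : E3) 1), ↥puncturedTube) :=
    ⟨fun q => ⟨(q.1, (q.2 : E3)), hfm q⟩, by fun_prop⟩
  have hgf : g.comp f = ContinuousMap.id _ := by
    ext q : 1
    obtain ⟨u, s⟩ := q
    have hs : ‖(s : E3)‖ = 1 := by
      have h := s.2; rwa [mem_sphere_zero_iff_norm] at h
    refine Prod.ext rfl (Subtype.ext ?_)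
    simp [f, g, hs]
  -- the straight-line homotopy from `f ∘ g` to the identity, inside the punctured tube
  have hcoef : ∀ (t : I) (p : ↥puncturedTube), 0 < (1 - (t : ℝ)) * ‖(p : S1 × E3).2‖⁻¹ + (t : ℝ) := by
    intro t p
    have ht0 : 0 ≤ (t : ℝ) := t.2.1
    have ht1 : (t : ℝ) ≤ 1 := t.2.2
    have hi : 0 < ‖(p : S1 × E3).2‖⁻¹ := inv_pos.2 (hpos p)
    rcases eq_or_lt_of_le ht0 with h0 | h0
    · rw [← h0]; simpa using hi
    · nlinarith
  have hmem : ∀ (t : I) (p : ↥puncturedTube),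
      (((p : S1 × E3).1, ((1 - (t : ℝ)) * ‖(p : S1 × E3).2‖⁻¹ + (t : ℝ)) • (p : S1 × E3).2) :
        S1 × E3) ∈ puncturedTube := fun t p =>
    ⟨trivial, smul_ne_zero (hcoef t p).ne' (hne p)⟩
  have hHc : Continuous fun q : I × ↥puncturedTube =>
      (((q.2 : S1 × E3).1, ((1 - (q.1 : ℝ)) * ‖(q.2 : S1 × E3).2‖⁻¹ + (q.1 : ℝ)) •
        (q.2 : S1 × E3).2) : S1 × E3) := by
    have h2 : Continuous fun q : I × ↥puncturedTube => (q.2 : S1 × E3).2 :=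
      continuous_snd.comp (continuous_subtype_val.comp continuous_snd)
    have h1 : Continuous fun q : I × ↥puncturedTube => (q.1 : ℝ) :=
      continuous_subtype_val.comp continuous_fst
    have h3 : Continuous fun q : I × ↥puncturedTube =>
        (1 - (q.1 : ℝ)) * ‖(q.2 : S1 × E3).2‖⁻¹ + (q.1 : ℝ) :=
      ((continuous_const.sub h1).mul (h2.norm.inv₀ fun q => (hpos q.2).ne')).add h1
    exact (continuous_fst.comp (continuous_subtype_val.comp continuous_snd)).prodMk (h3.smul h2)
  let H : (f.comp g).Homotopy (ContinuousMap.id ↥puncturedTube) :=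
    { toFun := fun q => ⟨(((q.2 : S1 × E3).1,
          ((1 - (q.1 : ℝ)) * ‖(q.2 : S1 × E3).2‖⁻¹ + (q.1 : ℝ)) • (q.2 : S1 × E3).2) : S1 × E3),
          hmem q.1 q.2⟩
      continuous_toFun := hHc.subtype_mk fun q => hmem q.1 q.2
      map_zero_left := fun p => by
        apply Subtype.ext
        simp [f, g]
      map_one_left := fun p => by
        apply Subtype.ext
        simp }
  exact
    ⟨{ toFun := g
       invFun := f
       left_inv := ⟨H⟩
       right_inv := by rw [hgf] }⟩

/-- **`χ(S¹ × (ℝ³ ∖ 0)) = 0`, with finiteness** (`≃ₕ S¹ × S²`, `χ(S¹ × S²) = 0`).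
[cite: HatcherAT2002, Cor. 2.11 and Thm. 2.44] -/
theorem finRelHomology_puncturedTube :
    FinRelHomology ℤ ℤ ↥((Set.univ : Set ↥(Metric.sphere (0 : EuclideanSpace ℝ (Fin 2)) 1)) ×ˢ
        ({0}ᶜ : Set (EuclideanSpace ℝ (Fin 3)))) ∅ 4 ∧
      relEuler ℤ ℤ ↥((Set.univ : Set ↥(Metric.sphere (0 : EuclideanSpace ℝ (Fin 2)) 1)) ×ˢ
        ({0}ᶜ : Set (EuclideanSpace ℝ (Fin 3)))) ∅ = 0 :=
  finRelHomology_and_relEuler_of_homotopyEquiv nonempty_homotopyEquiv_puncturedTube.some.symm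
    finRelHomology_sphereOne_prod_sphereTwo

end Literature.Topology.FourManifolds

end
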